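import Summits.CriticalPhenomena.PercolationContinuityZ3.Theorems.Transplant.FKConnectivityAllQPat3ShapeZero
import Summits.CriticalPhenomena.PercolationContinuityZ3.Theorems.Transplant.FKConnectivityAllQPat3C1Plus
import HarnessLib

/-!
# Connectivity correlation inequalities for `φ_{w,q}`, every `q > 0` — THE BRIDGE ROW B0 (census g39 §3): the eleven `famP11`
# tables are levelwise nonnegative on the bridge graph `K₄ - ab` itself, inner mark at `c` or at `d` (exact base, kernel)

Data file (`--supports stmt-CriticalPhenomena-4575`), census lineage (gen 40) of LANE 2's FK sub-programme; builds on p205010 (kernel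
theorem, internal audit signed; external expert review pending).  `decide +kernel` facts; no sorries; standard axioms.

`FK.skelB0 = [ac, ad, bc, bd, cd]` on names `a b c d = 0 1 2 3`; for each member `F` of `FK.famP11` (its eleven tables by name) and
`s ∈ {c, d}`: `FK.bridgeB0c_<F>` / `FK.bridgeB0d_<F>` : `FK.baseCheck0 skelB0 0 1 2 F = true` (resp. mark name `3`).  With
`FK.shape0_nonneg_of_check`: `0 ≤ lev2 E a b s F μ` for the bridge `E` on any four distinct vertices — census g39's 𝒯₂-leaf B0
(«T2goal at a bridge with the inner mark at a vertex: the bridge graph itself, exact base»).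
[cite: AyyerLinussonRavichandran2025, §7 (p. 22)]
-/

namespace Summit.CriticalPhenomena.PercolationContinuityZ3.Theorems

namespace FK

open SimpleGraph Literature.Probability.LatticeModels Literature.Probability.Percolation
open scoped Classical

variable {V : Type*}
/-- The bridge graph `K₄ - ab` on names `a b c d = 0 1 2 3`: edges `ac, ad, bc, bd, cd`. [folklore] -/
def skelB0 : List (Fin 4 × Fin 4) := [(0, 2), (0, 3), (1, 2), (1, 3), (2, 3)]

/-- Exact base B0 (census g39 §3, 𝒯₂-leaf: the bridge graph itself, inner mark at the vertex `c`): `tsym2Tab` is nonnegative at every residual level (kernel). -/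
theorem bridgeB0c_tsym : baseCheck0 skelB0 (0 : Fin 4) 1 2 tsym2Tab = true := by
  decide +kernel

/-- Exact base B0 (census g39 §3, 𝒯₂-leaf: the bridge graph itself, inner mark at the vertex `d`): `tsym2Tab` is nonnegative at every residual level (kernel). -/
theorem bridgeB0d_tsym : baseCheck0 skelB0 (0 : Fin 4) 1 3 tsym2Tab = true := by
  decide +kernel

/-- Exact base B0 (census g39 §3, 𝒯₂-leaf: the bridge graph itself, inner mark at the vertex `c`): `starXTab` is nonnegative at every residual level (kernel). -/
theorem bridgeB0c_starX : baseCheck0 skelB0 (0 : Fin 4) 1 2 starXTab = true := by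
  decide +kernel

/-- Exact base B0 (census g39 §3, 𝒯₂-leaf: the bridge graph itself, inner mark at the vertex `d`): `starXTab` is nonnegative at every residual level (kernel). -/
theorem bridgeB0d_starX : baseCheck0 skelB0 (0 : Fin 4) 1 3 starXTab = true := by
  decide +kernel

/-- Exact base B0 (census g39 §3, 𝒯₂-leaf: the bridge graph itself, inner mark at the vertex `c`): `(mirror2 starXTab)` is nonnegative at every residual level (kernel). -/
theorem bridgeB0c_starXm : baseCheck0 skelB0 (0 : Fin 4) 1 2 (mirror2 starXTab) = true := by
  decide +kernel

/-- Exact base B0 (census g39 §3, 𝒯₂-leaf: the bridge graph itself, inner mark at the vertex `d`): `(mirror2 starXTab)` is nonnegative at every residual level (kernel). -/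
theorem bridgeB0d_starXm : baseCheck0 skelB0 (0 : Fin 4) 1 3 (mirror2 starXTab) = true := by
  decide +kernel

/-- Exact base B0 (census g39 §3, 𝒯₂-leaf: the bridge graph itself, inner mark at the vertex `c`): `starSTab` is nonnegative at every residual level (kernel). -/
theorem bridgeB0c_starS : baseCheck0 skelB0 (0 : Fin 4) 1 2 starSTab = true := by
  decide +kernel

/-- Exact base B0 (census g39 §3, 𝒯₂-leaf: the bridge graph itself, inner mark at the vertex `d`): `starSTab` is nonnegative at every residual level (kernel). -/
theorem bridgeB0d_starS : baseCheck0 skelB0 (0 : Fin 4) 1 3 starSTab = true := by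
  decide +kernel

/-- Exact base B0 (census g39 §3, 𝒯₂-leaf: the bridge graph itself, inner mark at the vertex `c`): `c1plusTab` is nonnegative at every residual level (kernel). -/
theorem bridgeB0c_c1plus : baseCheck0 skelB0 (0 : Fin 4) 1 2 c1plusTab = true := by
  decide +kernel

/-- Exact base B0 (census g39 §3, 𝒯₂-leaf: the bridge graph itself, inner mark at the vertex `d`): `c1plusTab` is nonnegative at every residual level (kernel). -/
theorem bridgeB0d_c1plus : baseCheck0 skelB0 (0 : Fin 4) 1 3 c1plusTab = true := by
  decide +kernel

/-- Exact base B0 (census g39 §3, 𝒯₂-leaf: the bridge graph itself, inner mark at the vertex `c`): `c2Tab` is nonnegative at every residual level (kernel). -/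
theorem bridgeB0c_c2 : baseCheck0 skelB0 (0 : Fin 4) 1 2 c2Tab = true := by
  decide +kernel

/-- Exact base B0 (census g39 §3, 𝒯₂-leaf: the bridge graph itself, inner mark at the vertex `d`): `c2Tab` is nonnegative at every residual level (kernel). -/
theorem bridgeB0d_c2 : baseCheck0 skelB0 (0 : Fin 4) 1 3 c2Tab = true := by
  decide +kernel

/-- Exact base B0 (census g39 §3, 𝒯₂-leaf: the bridge graph itself, inner mark at the vertex `c`): `(mirror2 c2Tab)` is nonnegative at every residual level (kernel). -/
theorem bridgeB0c_c2m : baseCheck0 skelB0 (0 : Fin 4) 1 2 (mirror2 c2Tab) = true := by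
  decide +kernel

/-- Exact base B0 (census g39 §3, 𝒯₂-leaf: the bridge graph itself, inner mark at the vertex `d`): `(mirror2 c2Tab)` is nonnegative at every residual level (kernel). -/
theorem bridgeB0d_c2m : baseCheck0 skelB0 (0 : Fin 4) 1 3 (mirror2 c2Tab) = true := by
  decide +kernel

/-- Exact base B0 (census g39 §3, 𝒯₂-leaf: the bridge graph itself, inner mark at the vertex `c`): `s1c1Tab` is nonnegative at every residual level (kernel). -/
theorem bridgeB0c_s1c1 : baseCheck0 skelB0 (0 : Fin 4) 1 2 s1c1Tab = true := by
  decide +kernel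

/-- Exact base B0 (census g39 §3, 𝒯₂-leaf: the bridge graph itself, inner mark at the vertex `d`): `s1c1Tab` is nonnegative at every residual level (kernel). -/
theorem bridgeB0d_s1c1 : baseCheck0 skelB0 (0 : Fin 4) 1 3 s1c1Tab = true := by
  decide +kernel

/-- Exact base B0 (census g39 §3, 𝒯₂-leaf: the bridge graph itself, inner mark at the vertex `c`): `(mirror2 s1c1Tab)` is nonnegative at every residual level (kernel). -/
theorem bridgeB0c_s1c1m : baseCheck0 skelB0 (0 : Fin 4) 1 2 (mirror2 s1c1Tab) = true := by
  decide +kernel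

/-- Exact base B0 (census g39 §3, 𝒯₂-leaf: the bridge graph itself, inner mark at the vertex `d`): `(mirror2 s1c1Tab)` is nonnegative at every residual level (kernel). -/
theorem bridgeB0d_s1c1m : baseCheck0 skelB0 (0 : Fin 4) 1 3 (mirror2 s1c1Tab) = true := by
  decide +kernel

/-- Exact base B0 (census g39 §3, 𝒯₂-leaf: the bridge graph itself, inner mark at the vertex `c`): `s1c3Tab` is nonnegative at every residual level (kernel). -/
theorem bridgeB0c_s1c3 : baseCheck0 skelB0 (0 : Fin 4) 1 2 s1c3Tab = true := by
  decide +kernel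

/-- Exact base B0 (census g39 §3, 𝒯₂-leaf: the bridge graph itself, inner mark at the vertex `d`): `s1c3Tab` is nonnegative at every residual level (kernel). -/
theorem bridgeB0d_s1c3 : baseCheck0 skelB0 (0 : Fin 4) 1 3 s1c3Tab = true := by
  decide +kernel

/-- Exact base B0 (census g39 §3, 𝒯₂-leaf: the bridge graph itself, inner mark at the vertex `c`): `(mirror2 s1c3Tab)` is nonnegative at every residual level (kernel). -/
theorem bridgeB0c_s1c3m : baseCheck0 skelB0 (0 : Fin 4) 1 2 (mirror2 s1c3Tab) = true := by
  decide +kernel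

/-- Exact base B0 (census g39 §3, 𝒯₂-leaf: the bridge graph itself, inner mark at the vertex `d`): `(mirror2 s1c3Tab)` is nonnegative at every residual level (kernel). -/
theorem bridgeB0d_s1c3m : baseCheck0 skelB0 (0 : Fin 4) 1 3 (mirror2 s1c3Tab) = true := by
  decide +kernel

end FK

end Summit.CriticalPhenomena.PercolationContinuityZ3.Theorems
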